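/-
Copyright: lit-balaban cell, Phase-2 proof seat p33 (gen 11).  Statement-level skeleton of a published paper; no proof claims beyond
what the kernel checks below.
-/
import Literature.MathematicalPhysics.QuantumFieldTheory.BalabanImbrieJaffe1984to88.BIJ85EdgeColumnSums

/-!
# `BalabanImbrieJaffe1984to88.BIJ85LineSumReflectionD` — T. Bałaban, J. Imbrie, A. Jaffe, *Renormalization of the Higgs model:
minimizers, propagators and the stability of mean field theory*, Commun. Math. Phys. **97** (1985) 299–329 [BalabanImbrieJaffe1985],
§7.3 p. 326: **the unit-bond line sums of the correction `T_kg = 𝒟_k∂*Q^{e*}_kg` of the second printed form of (7.3.2) are bounded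
UNIFORMLY IN THE NUMBER OF SCALES `k` ON EVERY TORUS OF EVERY DIMENSION `d ≥ 2`, hypothesis-free** — p11's located constant
`BIJ85Claim73SecondForm.SecClosedIdx.hT` holds with ONE `K_T` for all `k` (file 2/2 of the gen-11 member of SKELETON row
**C1.Eq7.3.1-7.3.2**, GAPS G-C1-05 ADDENDUM 10 «WHAT REMAINS»: *(γ′) for d ≥ 3 (cancellation via the full hypercubic symmetrisation …),
(ε) for d ≥ 3, (δ) only in d ≥ 3*; gen 10's `BIJ85LineSumReflection` is the case `d = 2`; file 1: `BIJ85EdgeColumnSums`).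

statement-level skeleton of published theorems with citation tags; proofs where landed; nothing here is a claim about the Yang–Mills mass gap

THE PRINTED TEXT.  p. 326 [PDF 28], verbatim: *"The second form of the inequality substitutes v_b for u_k(b) in the covariant derivative
of φ. These inequalities can be proved by an extension of the proofs of [7]."*  The paper treats `d = 2, 3` ((Higgs)₂,₃); gen 10 proved
the k-uniform line-sum constant for `d = 2` only (its HONEST SCOPE (i): in `d ≥ 3` *"the near sources of a line are the plaquettes adjacent
to the (d−2)-cells through it and the symmetrisation over ONE c_ν kills only those containing ν"*, and the residual bound needs closed `g`).

THE ARGUMENT (every statement below is a theorem of this file or of file 1).  Let `c = ⟨y′, μ⟩` be a unit bond of `T^{(k)}`, `x₀ = L^k·y′`,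
`ℓ = {⟨x₀ + te_μ, μ⟩ : t < L^k}`, and for `ν ≠ μ` let `S_ν = c_ν ∘ τ_{2y′_νe_ν}` be gen 10's reflection through `{x_ν = (x₀)_ν − ½}`
(`T_kS_ν^* = S_ν^*T_k`, `S_νℓ = ℓ − e_ν`).  Call a unit plaquette NEAR in the direction `λ ≠ μ` if `λ` is one of its directions and its
`λ`-row is `y′_λ − 1`.  (1) §2 `le_supDist_of_mem_edgeB`: a plaquette that is near in NO direction `λ ≠ μ` has all its edge plaquettes at
sup-distance `≥ L^k − 1` from `ℓ` (one of its two directions differs from `μ`; gen 10's `le_cdist_of_ne` in that coordinate) — so for a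
field vanishing on all near plaquettes file 1's far bound `eta_abs_sum_TkF_far_le` applies.  (2) §3 `eta_abs_sum_TkF_le_induct`, induction
on a set `R ∌ μ` of directions still to be treated, for CLOSED `g` with `|g| ≤ C` vanishing on the near plaquettes of every `λ ∉ R`:
`η|Σ_ℓT_kg| ≤ (K_far + |R|·K_s/2)·C` with `K_s = 2K_∞ + 1 + K_R`.  Step `R = R′ ∪ {ν}`: `2Σ_ℓT_kg = Σ_ℓT_k(g + S_ν^*g) + (Σ_ℓ − Σ_{ℓ−e_ν})T_kg`;
the symmetrised field is CLOSED (§1: `d` is additive, commutes with `τ_v` and anti-commutes with `c_ν` up to the reflected base point —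
`dPlaq_reflP_fst/snd/thd/of_ne`), bounded by `2C`, vanishes on the near plaquettes of `ν` (gen 10's `symm_apply_of_fixed`) and still on
those of every `λ ∉ R′ ∪ {ν}` (§2 `symm_apply_eq_zero_of_ne`: `S_ν` keeps directions and `λ`-coordinates), so the induction hypothesis
gives `(K_far + |R′|K_s/2)·2C`; the strip term is gen 10's `eta_abs_strip_le` (Stokes; residual bound `K_R` for the closed `g`, pointwise
bound `K_∞` of file 1).  (3) `R = univ ∖ {μ}` (vacuous vanishing hypothesis): `K_T = K_far + (d−1)(K_∞ + (1+K_R)/2)`.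

WHAT THIS FILE PROVES (0 `sorry`; no `def`, no `Prop` fact; standing range `k ≤ m + K`).
* §1 `dPlaq_add`, `dPlaq_translP`, `dPlaq_reflP_of_ne/fst/snd/thd`, **`dPlaq_reflP_eq_zero`**, **`dPlaq_symm_add_eq_zero`** (closedness
  is preserved by `g ↦ g + S_ν^*g`), `isClosedPlaq_iff_dPlaq`.
* §2 `symm_apply_eq_zero_of_ne`, `dir_eq_of_mem_edgeB`, **`le_supDist_of_mem_edgeB`** (every `d`), **`far_of_vanish`**.
* §3 **`eta_abs_sum_TkF_le_induct`**.
* §4 **`eta_abs_lineSumIter_TkF_le_uniform`** (per torus, given (7.2.2)–(7.2.3) and the residual bound for closed fields) and,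
  HYPOTHESIS-FREE, **`exists_KT_uniform_allTori`**: for every `d ≥ 2` and odd `L > 1` ONE `K_T ≥ 0` with `η·|Σ_{b′⊂c}(T_kg)_{b′}| ≤ K_T·max|g|`
  for ALL tori with `P.d = d`, `P.L = L`, ALL `k ≤ m + K`, all CLOSED `g`, all unit bonds (inputs: p16/p19 `exists_absH_le_allTori` /
  `exists_gradB_allTori`, `abs_H_zero_le`, r18 `ineq723_CE`, p33 `exists_KR_allTori`); **`secClosedIdx_allTori_uniform`**: p11's
  `SecClosedIdx d K_R K_T 𝓅` is total over the actual Sect. 7.3 data of every torus of dimension `d` at ONE `(K_R, K_T)`.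
* §5 **`claim73_second_closed_allTori_uniform`** (r15's `Claim73 𝓅`, second printed form, ONE family `SecClosedIdx d K_R K_T 𝓅` with `γ`,
  `α`, `M` independent of `k`, containing all actual data) and **`norm_lineIter_actualBgU1_sub_vK_le_uniform`** (`‖u_k(c) − v_c‖ ≤
  e·K_T·(π/2)𝓅(e)` on every torus of dimension `d` under (7.3.1) with `e𝓅(e) ≤ ½`, one `K_T` for all scales).
HONEST SCOPE.  (i) Every `d ≥ 2`; CLOSED `g` (exactly the quantifier of the typed slot `SecClosedIdx.hT`; in `d = 2` every `g` is closed
and gen 10's file covers all `g`).  (ii) Constants explicit, far from optimal (`K_T` grows like `d!`-type factors of file 1); `U = 1`,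
real fields, torus, standing range, operators OF RECORD (`HkE`, `CE`, `DkE`, `QesOp`, `TkF`).  (iii) The symmetry is that of the TREE's
centred conventions (`Setup.blockOf`/`emb`, `IsAxial`; DIVERGENCE F3), as in gen 10: print's corner-rooted contours are not the
tree's; nothing printed is contradicted, no statement weakened, no typed slot altered — the result INSTANTIATES `SecClosedIdx.hT`
verbatim with a k-independent `K_T` in every dimension, which is what the printed use of (7.3.2) at the last step requires
(GAPS G-C1-05 ADD. 7 SUPPL. 3).

CITATION HEADER (lean-in-tree rule).  Phase-2 file of the lit-balaban TYPED SKELETON (HOME `run/shared/lean/pub/lit-balaban/`), seat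
p33 gen 11 (unit `lit-balaban-p33-g11`; TAKING line HOME/STATUS.md 2026-08-22T05:5xZ; owner r15, referee ref-5).
-/

open scoped BigOperators RealInnerProductSpace
open Finset

namespace Literature.MathematicalPhysics.QuantumFieldTheory.BalabanImbrieJaffe1984to88.BIJ85LineSumReflectionD

open Literature.MathematicalPhysics.QuantumFieldTheory.Balaban1983to89 hiding Site Plaq
open Balaban1983to89.LatticeFieldCalculus hiding runSite runBond runSite_zero
open Balaban1983to89.B3TorusRadialSums (cdist cdist_le_supDist)
open Balaban1983to89.B5Eq118OneStroke (iterBlockOf)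
open Balaban1983to89.B7SectAStatements (blockOfIter)
open BIJ85AxialPropagator411 (BondSpace toE curlOp)
open BIJ85Prop521Torus (CoarseSpace toEj)
open BIJ85Prop522Torus (HkE CE DkE)
open BIJ85Sigma421Torus (UnitPlaqSpace toU QesOp)
open BIJ85Sigma422Eta (eta_pos eta_inv)
open BIJ85CellAverages (Cells)
open BIJ85Eq224Base0 (torusEdgeCellsTo)
open BIJ85BlockAveragesTorus (runSite runBond runSite_zero runSite_shift)
open BIJ85BlockAveragesTorusK (cornerIter)
open BIJ85Ineq732SecondForm (lineSumIter)
open BIJ88Eq541Base0 (TkF)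
open BIJ85LineSumTkKernel (lineSumIter_eq_sum_runBond lineSumIter_TkF_eq)
open BIJ85Sect7Statements BIJ85Ineq722Torus
open BIJ85Ineq722DeltaA (deltaAData)
open BIJ85Sect72AllToriHolds (exists_absH_le_allTori exists_gradB_allTori)
open BIJ85Sect72AllTori (abs_H_zero_le)
open BIJ85Ineq723TorusCE (ineq723_CE)
open BIJ85Eq454PlaqResidual (resE)
open BIJ85Claim73AllTori (exists_KR_allTori closedIdx_allTori)
open BIJ85Claim73Closed (dPlaq ClosedIdx)
open BIJ85Claim73SecondForm (SecClosedIdx)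
open BIJ85UnitTorusHodge (IsClosedPlaq isClosedPlaq_iff_cube)
open BIJ85Sect1Model (U1Field)
open BIJ85TorusReflections BIJ85TkCovariance
open BIJ85SigmaTranslationInvariance (translV translP translV_apply translP_apply)
open BIJ85LineSumReflection (val_scaleTo cornerIter_eq_scaleTo val_src_of_mem_edgeB le_cdist_of_ne runSite_apply_of_ne
  eta_abs_strip_le symVec symVec_apply sum_runBond_symm TkF_symm symm_apply_of_fixed)
open BIJ85EdgeColumnSums (eta_abs_TkF_le eta_abs_sum_TkF_far_le)
open BIJ88Sect3Statements (U1 toC)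
open BIJ85Sect1Model (plaq)
open BIJ85SmallFieldSplit64 (plaqField)
open BIJ85BlockAveragesTorusK (lineIter)
open BIJ85Eq454PlaqResidual (actualBgU1)
open BIJ85Claim73Closed (dPlaq_plaqField_eq_zero)
open BIJ85Claim73SecondForm (vK secClosedStabData claim73_second_closed norm_toC_lineIter_actualBgU1_sub_le abs_plaqField_le_of_hyp)
open Balaban1983to89 renaming Site → TSite, Plaq → TPlaq

noncomputable section

variable {P : Params}

/-! ## §1  Closedness is preserved by the symmetry `S = c_ν ∘ τ` -/

section Closed

variable {j : ℕ}

/-- kernel: the unit steps of the torus commute. [folklore] -/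
private theorem shift_shift_comm (x : TSite P j) (μ ν : Fin P.d) : (x.shift μ).shift ν = (x.shift ν).shift μ := by
  rcases eq_or_ne μ ν with rfl | h
  · rfl
  · funext lam
    simp only [Site.shift_apply]
    by_cases h1 : lam = ν
    · subst h1; simp [Ne.symm h]
    · by_cases h2 : lam = μ
      · subst h2; simp [h1]
      · simp [h1, h2]

/-- kernel: `d` is additive. [cite: BalabanImbrieJaffe1985, p.326 (text)] -/
theorem dPlaq_add (g h : TPlaq P j → ℝ) (x : TSite P j) {μ ν lam : Fin P.d} (hμν : μ < ν) (hνl : ν < lam) :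
    dPlaq (g + h) x hμν hνl = dPlaq g x hμν hνl + dPlaq h x hμν hνl := by
  simp only [dPlaq, Pi.add_apply]
  ring

/-- kernel: `d` commutes with the unit-lattice translations: `d(τ_vg)(x) = (dg)(x + v)`. [cite: BalabanImbrieJaffe1985, p.326 (text)] -/
theorem dPlaq_translP (v : TSite P j) (g : TPlaq P j → ℝ) (x : TSite P j) {μ ν lam : Fin P.d} (hμν : μ < ν) (hνl : ν < lam) :
    dPlaq (translP v g) x hμν hνl = dPlaq g (x + v) hμν hνl := by
  simp only [dPlaq, translP_apply, Plaq.translate, Site.shift_add]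

/-- kernel: `d` and the centre reflection `c_ρ` in a direction off the cube: `d(c_ρg)(x) = (dg)(c_ρx)`.
[cite: BalabanImbrieJaffe1985, p.326 (text)] -/
theorem dPlaq_reflP_of_ne (ρ : Fin P.d) (g : TPlaq P j → ℝ) (x : TSite P j) {μ ν lam : Fin P.d} (hμν : μ < ν) (hνl : ν < lam)
    (hμ : μ ≠ ρ) (hν : ν ≠ ρ) (hl : lam ≠ ρ) :
    dPlaq (reflP ρ g) x hμν hνl = dPlaq g (crefl ρ x) hμν hνl := by
  simp only [dPlaq, reflP_apply, preflect, hμ, hν, hl, or_self, if_false, crefl_shift_of_ne ρ _ hμ, crefl_shift_of_ne ρ _ hν,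
    crefl_shift_of_ne ρ _ hl]

/-- kernel: `d` and the centre reflection in the FIRST direction of the cube: `d(c_μg)(x) = −(dg)(c_μx − e_μ)` (the reflected cube hangs
on the negative side, orientation reversed). [cite: BalabanImbrieJaffe1985, p.326 (text)] -/
theorem dPlaq_reflP_fst (g : TPlaq P j → ℝ) (x : TSite P j) {μ ν lam : Fin P.d} (hμν : μ < ν) (hνl : ν < lam) :
    dPlaq (reflP μ g) x hμν hνl = -dPlaq g ((crefl μ x).unshift μ) hμν hνl := by
  have hν : ν ≠ μ := ne_of_gt hμν
  have hl : lam ≠ μ := ne_of_gt (hμν.trans hνl)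
  simp only [dPlaq, reflP_apply, preflect, hν, hl, or_self, if_false, true_or, if_true, crefl_shift_self,
    crefl_shift_of_ne μ _ hν, crefl_shift_of_ne μ _ hl, shift_shift_comm _ ν μ, shift_shift_comm _ lam μ, Site.shift_unshift]
  ring

/-- kernel: `d` and the centre reflection in the SECOND direction of the cube: `d(c_νg)(x) = −(dg)(c_νx − e_ν)`.
[cite: BalabanImbrieJaffe1985, p.326 (text)] -/
theorem dPlaq_reflP_snd (g : TPlaq P j → ℝ) (x : TSite P j) {μ ν lam : Fin P.d} (hμν : μ < ν) (hνl : ν < lam) :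
    dPlaq (reflP ν g) x hμν hνl = -dPlaq g ((crefl ν x).unshift ν) hμν hνl := by
  have hμ : μ ≠ ν := ne_of_lt hμν
  have hl : lam ≠ ν := ne_of_gt hνl
  simp only [dPlaq, reflP_apply, preflect, hμ, hl, or_self, if_false, true_or, if_true, or_true, crefl_shift_self,
    crefl_shift_of_ne ν _ hμ, crefl_shift_of_ne ν _ hl, shift_shift_comm _ μ ν, shift_shift_comm _ lam ν, Site.shift_unshift]
  ring

/-- kernel: `d` and the centre reflection in the THIRD direction of the cube: `d(c_λg)(x) = −(dg)(c_λx − e_λ)`.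
[cite: BalabanImbrieJaffe1985, p.326 (text)] -/
theorem dPlaq_reflP_thd (g : TPlaq P j → ℝ) (x : TSite P j) {μ ν lam : Fin P.d} (hμν : μ < ν) (hνl : ν < lam) :
    dPlaq (reflP lam g) x hμν hνl = -dPlaq g ((crefl lam x).unshift lam) hμν hνl := by
  have hμ : μ ≠ lam := ne_of_lt (hμν.trans hνl)
  have hν : ν ≠ lam := ne_of_lt hνl
  simp only [dPlaq, reflP_apply, preflect, hμ, hν, or_self, if_false, if_true, or_true, crefl_shift_self,
    crefl_shift_of_ne lam _ hμ, crefl_shift_of_ne lam _ hν, shift_shift_comm _ μ lam, shift_shift_comm _ ν lam, Site.shift_unshift]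
  ring

/-- **CLOSEDNESS IS PRESERVED BY THE CENTRE REFLECTIONS**: `dg = 0 ⇒ d(c_ρg) = 0` on every cube (the four cases `ρ ∉ {μ,ν,λ}`,
`ρ = μ`, `ρ = ν`, `ρ = λ`). [cite: BalabanImbrieJaffe1985, p.326 (text)] -/
theorem dPlaq_reflP_eq_zero (ρ : Fin P.d) {g : TPlaq P j → ℝ}
    (hg : ∀ (x : TSite P j) (μ ν lam : Fin P.d) (hμν : μ < ν) (hνl : ν < lam), dPlaq g x hμν hνl = 0)
    (x : TSite P j) (μ ν lam : Fin P.d) (hμν : μ < ν) (hνl : ν < lam) : dPlaq (reflP ρ g) x hμν hνl = 0 := by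
  by_cases h1 : μ = ρ
  · subst h1; rw [dPlaq_reflP_fst, hg, neg_zero]
  by_cases h2 : ν = ρ
  · subst h2; rw [dPlaq_reflP_snd, hg, neg_zero]
  by_cases h3 : lam = ρ
  · subst h3; rw [dPlaq_reflP_thd, hg, neg_zero]
  rw [dPlaq_reflP_of_ne ρ g x hμν hνl h1 h2 h3, hg]

/-- **CLOSEDNESS IS PRESERVED BY THE SYMMETRISATION** `g ↦ g + c_ν τ_v g` (`d` additive, commutes with `τ_v`, anti-commutes with
`c_ν` up to the reflected base point). [cite: BalabanImbrieJaffe1985, p.326 (text)] -/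
theorem dPlaq_symm_add_eq_zero (ν : Fin P.d) (v : TSite P j) {g : TPlaq P j → ℝ}
    (hg : ∀ (x : TSite P j) (μ ν lam : Fin P.d) (hμν : μ < ν) (hνl : ν < lam), dPlaq g x hμν hνl = 0)
    (x : TSite P j) (μ ν' lam : Fin P.d) (hμν : μ < ν') (hνl : ν' < lam) :
    dPlaq (g + reflP ν (translP v g)) x hμν hνl = 0 := by
  rw [dPlaq_add, hg, zero_add]
  exact dPlaq_reflP_eq_zero ν (fun y α β γ h1 h2 => by rw [dPlaq_translP, hg]) x μ ν' lam hμν hνl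

/-- kernel: the cube criterion `isClosedPlaq_iff_cube` in terms of `dPlaq`. [cite: BalabanImbrieJaffe1985, §7.3 p.326] -/
theorem isClosedPlaq_iff_dPlaq (g : TPlaq P j → ℝ) :
    IsClosedPlaq g ↔ ∀ (x : TSite P j) (μ ν lam : Fin P.d) (hμν : μ < ν) (hνl : ν < lam), dPlaq g x hμν hνl = 0 :=
  isClosedPlaq_iff_cube g

end Closed

/-! ## §2  Near plaquettes: the symmetrised field off the treated directions; the distance lemma in every `d` -/

section Near

/-- kernel: `0 < L^n`. [folklore] -/
private theorem cast_pow_L_pos' (n : ℕ) : (0 : ℝ) < (P.L : ℝ) ^ n := pow_pos P.cast_L_pos n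

/-- kernel: there is a unit plaquette (`d ≥ 2`), so a uniform bound `|g| ≤ C` forces `0 ≤ C`. [folklore] -/
private theorem nonneg_of_bound' (hd : 2 ≤ P.d) {k : ℕ} {g : TPlaq P k → ℝ} {C : ℝ} (hg : ∀ q, |g q| ≤ C) : 0 ≤ C :=
  (abs_nonneg _).trans (hg ⟨default, ⟨0, by omega⟩, ⟨1, by omega⟩, by simp [Fin.lt_def]⟩)

/-- kernel: `|g + S^*g| ≤ 2·max|g|` (`S^*g` is `±g` at another plaquette). [cite: BalabanImbrieJaffe1985, (2.20) p.305] -/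
private theorem abs_symm_add_le {k : ℕ} (ν : Fin P.d) (y' : TSite P k) (g : TPlaq P k → ℝ) {C : ℝ} (hg : ∀ q, |g q| ≤ C)
    (q : TPlaq P k) : |(g + reflP ν (translP (symVec k ν y') g)) q| ≤ 2 * C := by
  rw [Pi.add_apply, reflP_apply, translP_apply]
  have h1 := hg q
  have h2 := hg ((preflect ν q).translate (symVec k ν y'))
  split_ifs
  · calc _ ≤ |g q| + |-(g ((preflect ν q).translate (symVec k ν y')))| := abs_add_le _ _
      _ ≤ 2 * C := by rw [abs_neg]; linarith
  · calc _ ≤ |g q| + |g ((preflect ν q).translate (symVec k ν y'))| := abs_add_le _ _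
      _ ≤ 2 * C := by linarith

/-- **THE SYMMETRY `S_ν` PRESERVES THE NEAR PLAQUETTES OF THE OTHER DIRECTIONS**: if `g` vanishes on every unit plaquette containing
the direction `λ ≠ ν` with `λ`-row `y′_λ − 1`, then so does `S_ν^*g = c_ν τ_{2y′_νe_ν} g` (`S_ν` keeps the directions of a plaquette and
the `λ`-coordinate of its base point). [cite: BalabanImbrieJaffe1985, (2.20) p.305] -/
theorem symm_apply_eq_zero_of_ne {k : ℕ} {ν lam : Fin P.d} (hlν : lam ≠ ν) (y' : TSite P k) {g : TPlaq P k → ℝ}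
    (hg : ∀ q : TPlaq P k, (q.μ = lam ∨ q.ν = lam) → q.src lam = y' lam - 1 → g q = 0)
    {q : TPlaq P k} (hql : q.μ = lam ∨ q.ν = lam) (hq : q.src lam = y' lam - 1) :
    reflP ν (translP (symVec k ν y') g) q = 0 := by
  have hsrc : ((preflect ν q).translate (symVec k ν y')).src lam = y' lam - 1 := by
    obtain ⟨x, α, β, hαβ⟩ := q
    simp only [preflect, Plaq.translate, Site.add_apply, symVec_apply, if_neg hlν, add_zero]
    simp only at hq
    split_ifs
    · rw [crefl_apply, if_neg hlν, Site.shift_apply, if_neg hlν, hq]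
    · rw [crefl_apply, if_neg hlν, hq]
  have hdir : ((preflect ν q).translate (symVec k ν y')).μ = lam ∨ ((preflect ν q).translate (symVec k ν y')).ν = lam := hql
  have h0 := hg _ hdir hsrc
  rw [reflP_apply, translP_apply]
  split_ifs
  · rw [h0, neg_zero]
  · exact h0

/-- kernel: an edge plaquette of `B^e_k(p)` has the directions of `p`. [cite: BalabanImbrieJaffe1985, (2.21) p.305] -/
theorem dir_eq_of_mem_edgeB (hd : 2 ≤ P.d) {k : ℕ} {p : TPlaq P k} {q : TPlaq P 0}
    (h : q ∈ (torusEdgeCellsTo P 0 k k (Nat.zero_add k) hd).B p) : p.μ = q.μ ∧ p.ν = q.ν := by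
  rw [Cells.mem_B] at h
  dsimp only [torusEdgeCellsTo] at h
  split_ifs at h with hc
  have h1 := Option.some.inj h
  exact ⟨by rw [← h1], by rw [← h1]⟩

/-- **FAR SOURCES, EVERY `d ≥ 2`**: a unit plaquette `p` of `T^{(k)}` such that for EVERY direction `λ ≠ μ` of `p` its `λ`-row is NOT the
row `y′_λ − 1` below the block of `y′` has all its edge plaquettes `q ∈ B^e_k(p)` at sup-distance `≥ L^k − 1` from every site of the
`μ`-line through the corner `L^k·y′` (one direction of `p` differs from `μ`; gen 10's `le_cdist_of_ne` in that coordinate; `k ≤ m + K`).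
(gen 10's `le_supDist_of_mem_edgeB_two` is the case `d = 2`.) [cite: BalabanImbrieJaffe1985, (7.2.2) p.325] -/
theorem le_supDist_of_mem_edgeB (hd : 2 ≤ P.d) {k : ℕ} (hk : k ≤ P.m + P.K) (y' : TSite P k) (μ : Fin P.d) {p : TPlaq P k}
    (hps : ∀ lam : Fin P.d, (p.μ = lam ∨ p.ν = lam) → lam ≠ μ → p.src lam ≠ y' lam - 1) {q : TPlaq P 0}
    (hq : q ∈ (torusEdgeCellsTo P 0 k k (Nat.zero_add k) hd).B p) (t : ℕ) :
    P.L ^ k - 1 ≤ supDist (runSite (Site.scaleTo k y') μ t) q.src := by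
  obtain ⟨hμq, hνq⟩ := dir_eq_of_mem_edgeB hd hq
  -- a direction of `p` different from `μ`
  obtain ⟨lam, hpl, hlμ, hql⟩ : ∃ lam, (p.μ = lam ∨ p.ν = lam) ∧ lam ≠ μ ∧ (lam = q.μ ∨ lam = q.ν) := by
    by_cases h : p.μ = μ
    · refine ⟨p.ν, Or.inr rfl, ?_, Or.inr hνq⟩
      intro e; have := p.hμν; rw [h, e] at this; exact lt_irrefl _ this
    · exact ⟨p.μ, Or.inl rfl, h, Or.inl hμq⟩
  have hxν : ((runSite (Site.scaleTo k y') μ t) lam).val = (y' lam).val * P.L ^ k := by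
    rw [runSite_apply_of_ne _ hlμ, val_scaleTo hk]
  have hqν : (q.src lam).val + 1 = ((p.src lam).val + 1) * P.L ^ k := val_src_of_mem_edgeB hd hk hq hql
  exact (le_cdist_of_ne hk hxν hqν (hps lam hpl hlμ)).trans (cdist_le_supDist _ _ lam)

/-- **AFTER THE FULL SYMMETRISATION EVERY SOURCE IS FAR**: if `g` vanishes on every unit plaquette containing a direction `λ ≠ μ` with
`λ`-row `y′_λ − 1`, then every plaquette charged by `g` has all its edge plaquettes at sup-distance `≥ L^k − 1` from the line (the
hypothesis `hfar` of `BIJ85EdgeColumnSums.eta_abs_sum_TkF_far_le`). [cite: BalabanImbrieJaffe1985, (7.3.2) p.326] -/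
theorem far_of_vanish (hd : 2 ≤ P.d) {k : ℕ} (hk : k ≤ P.m + P.K) (y' : TSite P k) (μ : Fin P.d) {g : TPlaq P k → ℝ}
    (hvan : ∀ lam : Fin P.d, lam ≠ μ → ∀ q : TPlaq P k, (q.μ = lam ∨ q.ν = lam) → q.src lam = y' lam - 1 → g q = 0)
    {p : TPlaq P k} (hp : g p ≠ 0) {q : TPlaq P 0} (hq : q ∈ (torusEdgeCellsTo P 0 k k (Nat.zero_add k) hd).B p) (t : ℕ) :
    (P.L : ℝ) ^ k - 1 ≤ (supDist (runSite (Site.scaleTo k y') μ t) q.src : ℝ) := by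
  have hps : ∀ lam : Fin P.d, (p.μ = lam ∨ p.ν = lam) → lam ≠ μ → p.src lam ≠ y' lam - 1 :=
    fun lam hpl hlμ e => hp (hvan lam hlμ p hpl e)
  have h := le_supDist_of_mem_edgeB hd hk y' μ hps hq t
  have hT : 1 ≤ P.L ^ k := Nat.one_le_pow _ _ P.L_pos
  have h' : (((P.L ^ k - 1 : ℕ)) : ℝ) ≤ (supDist (runSite (Site.scaleTo k y') μ t) q.src : ℝ) := by exact_mod_cast h
  rw [Nat.cast_sub hT, Nat.cast_pow, Nat.cast_one] at h'
  exact h'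

end Near

/-! ## §3  The induction over the directions `ν ≠ μ`: one symmetrisation per direction -/

section Induction

/-- **THE k-UNIFORM LINE-SUM BOUND BY INDUCTION ON THE TREATED DIRECTIONS** (`k ≤ m + K`, every `d ≥ 2`): let `R ∌ μ` be a set of
directions and `g` a CLOSED unit-lattice plaquette function with `|g| ≤ C` that vanishes on every unit plaquette containing a
direction `λ ∉ R`, `λ ≠ μ`, with `λ`-row `y′_λ − 1`.  Then `η·|Σ_{t<L^k}(T_kg)(L^k·y′ + te_μ)| ≤ (K_far + |R|·K_s/2)·C`, `K_s = 2K_∞ + 1 + K_R`: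
for `R = ∅` every source is far (§2, file 1's `eta_abs_sum_TkF_far_le`); for `R = R′ ∪ {ν}` symmetrise in `ν` —
`2Σ_ℓT_kg = Σ_ℓT_k(g + S_ν^*g) + (Σ_ℓ − Σ_{ℓ−e_ν})T_kg`, the first by induction (`g + S_ν^*g` is closed (§1), `≤ 2C`, and vanishes on the
near plaquettes of `ν` (gen 10's `symm_apply_of_fixed`) and of every `λ ∉ R′ ∪ {ν}` (§2)), the second by gen 10's strip estimate
`eta_abs_strip_le` (Stokes: residual bound `K_R` for the closed `g`, pointwise bound `K_∞` of file 1).  Given (7.2.2) for every `H_j`,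
(7.2.3) for every `C^{(j)}`, `j < k`, and the residual bound for every closed field. [cite: BalabanImbrieJaffe1985, (7.3.2) p.326] -/
theorem eta_abs_sum_TkF_le_induct (hd : 2 ≤ P.d) {k : ℕ} (hk : k ≤ P.m + P.K) {a : ℝ} (ha : 0 < a)
    {δ M δC MC : ℝ} (hδ : 0 < δ) (hδC : 0 < δC) (hMC : 0 ≤ MC)
    (hH : ∀ (j : ℕ) (hj : j ≤ P.m + P.K), j < k → ∀ (μ ν : Fin P.d) (x : TSite P 0) (y : TSite P j),
      |(torusRep P j (deltaAData hj a)).H (x, μ) (y, ν)| ≤ M * Real.exp (-(δ * distEU P j x y)))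
    (hB : ∀ (j : ℕ) (hj : j ≤ P.m + P.K), j < k → ∀ (μ ν : Fin P.d) (x : TSite P 0) (y : TSite P j),
      ‖fun lam : Fin P.d => (P.L : ℝ) ^ j *
          ((torusRep P j (deltaAData hj a)).H (x.shift lam, μ) (y, ν) - (torusRep P j (deltaAData hj a)).H (x, μ) (y, ν))‖ ≤
        M * Real.exp (-(δ * distEU P j x y)))
    (hC : ∀ j < k, ∀ b₁ b₂ : PBond P j, |⟪toEj P j (Pi.single b₁ 1),
      CE P ((P.eta j) ^ P.d) ((P.L : ℝ) ^ j) j (toEj P j (Pi.single b₂ 1))⟫| ≤ MC * Real.exp (-(δC * (supDist b₁.src b₂.src : ℝ))))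
    {KR : ℝ}
    (hKR : ∀ g : TPlaq P k → ℝ, (∀ (x : TSite P k) (μ ν lam : Fin P.d) (hμν : μ < ν) (hνl : ν < lam), dPlaq g x hμν hνl = 0) →
      ∀ C : ℝ, 0 ≤ C → (∀ q, |g q| ≤ C) →
        ∀ p : TPlaq P 0, |resE hd ((P.eta k) ^ P.d) (P.eta k)⁻¹ k (toU P k g) p| ≤ KR * Real.sqrt ((P.eta k) ^ P.d) * C)
    (y' : TSite P k) (μ : Fin P.d) (R : Finset (Fin P.d)) (hμR : μ ∉ R)
    (g : TPlaq P k → ℝ) {C : ℝ}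
    (hcl : ∀ (x : TSite P k) (μ ν lam : Fin P.d) (hμν : μ < ν) (hνl : ν < lam), dPlaq g x hμν hνl = 0)
    (hg : ∀ q, |g q| ≤ C)
    (hvan : ∀ lam : Fin P.d, lam ∉ R → lam ≠ μ → ∀ q : TPlaq P k, (q.μ = lam ∨ q.ν = lam) → q.src lam = y' lam - 1 → g q = 0) :
    P.eta k * |∑ t ∈ range (P.L ^ k), TkF P hd ((P.eta k) ^ P.d) (P.eta k) k g (runBond (Site.scaleTo k y') μ t)| ≤
      ((2 * M ^ 2 * MC * (P.d : ℝ) ^ 2 * (Real.exp (min δ δC / 2 / 2) * ((2 * (1 + P.d / (min δ δC / 2))) ^ P.d) ^ 2) *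
        (2 * (1 + 2 / (2 * (min δ δC / 2) / 3)) * Real.exp (3 * (2 * (min δ δC / 2) / 3) / 4) *
          ((P.d : ℝ) ^ 2 * (Real.exp ((2 * (min δ δC / 2) / 3) / 2 / 2) *
            (2 * (1 + P.d / ((2 * (min δ δC / 2) / 3) / 2))) ^ P.d))) *
        (Real.exp (min δ δC / 2 / 6) * (P.d - 2).factorial * ((min δ δC / 2 / 6)⁻¹) ^ (P.d - 2)) *
        (1 - Real.exp (-(min δ δC / 2 / 6)))⁻¹) +
      R.card * (2 * (2 * (2 * M ^ 2 * MC * (P.d : ℝ) ^ 2 * (Real.exp (min δ δC / 2 / 2) * ((2 * (1 + P.d / (min δ δC / 2))) ^ P.d) ^ 2) *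
        ((P.d : ℝ) ^ 2 * (2 * (1 + P.d / (min δ δC / 2))) ^ P.d))) + 1 + KR) / 2) * C := by
  -- names for the constants of file 1
  set Kfar : ℝ := 2 * M ^ 2 * MC * (P.d : ℝ) ^ 2 * (Real.exp (min δ δC / 2 / 2) * ((2 * (1 + P.d / (min δ δC / 2))) ^ P.d) ^ 2) *
        (2 * (1 + 2 / (2 * (min δ δC / 2) / 3)) * Real.exp (3 * (2 * (min δ δC / 2) / 3) / 4) *
          ((P.d : ℝ) ^ 2 * (Real.exp ((2 * (min δ δC / 2) / 3) / 2 / 2) *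
            (2 * (1 + P.d / ((2 * (min δ δC / 2) / 3) / 2))) ^ P.d))) *
        (Real.exp (min δ δC / 2 / 6) * (P.d - 2).factorial * ((min δ δC / 2 / 6)⁻¹) ^ (P.d - 2)) *
        (1 - Real.exp (-(min δ δC / 2 / 6)))⁻¹ with hKfar
  set Kinf : ℝ := 2 * (2 * M ^ 2 * MC * (P.d : ℝ) ^ 2 * (Real.exp (min δ δC / 2 / 2) * ((2 * (1 + P.d / (min δ δC / 2))) ^ P.d) ^ 2) *
        ((P.d : ℝ) ^ 2 * (2 * (1 + P.d / (min δ δC / 2))) ^ P.d)) with hKinf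
  set Ks : ℝ := 2 * Kinf + 1 + KR with hKs
  have hη : 0 < P.eta k := eta_pos P k
  -- the pointwise bound of file 1, for every field
  have hinf : ∀ (h : TPlaq P k → ℝ) (D : ℝ), (∀ q, |h q| ≤ D) → ∀ b : PBond P 0,
      P.eta k * |TkF P hd ((P.eta k) ^ P.d) (P.eta k) k h b| ≤ Kinf * D := fun h D hh b => by
    rw [hKinf]; exact eta_abs_TkF_le hd hk ha hδ hδC hMC hH hB hC h hh b
  -- induction on the set of directions still to be treated
  induction R using Finset.induction_on generalizing g C with
  | empty =>
    have hfar := eta_abs_sum_TkF_far_le hd hk ha hδ hδC hMC hH hB hC (Site.scaleTo k y') μ g hg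
      (fun p hp q hq t _ => far_of_vanish hd hk y' μ (fun lam hlμ => hvan lam (Finset.notMem_empty _) hlμ) hp hq t)
    rw [Finset.card_empty, Nat.cast_zero, zero_mul, zero_div, add_zero, hKfar]
    exact hfar
  | insert ν R hνR ih =>
    have hμν : μ ≠ ν := fun e => hμR (e ▸ Finset.mem_insert_self _ _)
    have hμR' : μ ∉ R := fun h => hμR (Finset.mem_insert_of_mem h)
    have hC0 : 0 ≤ C := nonneg_of_bound' hd hg
    set A := TkF P hd ((P.eta k) ^ P.d) (P.eta k) k g with hA
    set gS : TPlaq P k → ℝ := reflP ν (translP (symVec k ν y') g) with hgS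
    -- the symmetrised field: closed, bounded by 2C, vanishing on the near plaquettes of ν and of every untreated λ
    have hcl' : ∀ (x : TSite P k) (α β γ : Fin P.d) (h1 : α < β) (h2 : β < γ), dPlaq (g + gS) x h1 h2 = 0 :=
      dPlaq_symm_add_eq_zero ν (symVec k ν y') hcl
    have hg' : ∀ q, |(g + gS) q| ≤ 2 * C := abs_symm_add_le ν y' g hg
    have hvan' : ∀ lam : Fin P.d, lam ∉ R → lam ≠ μ → ∀ q : TPlaq P k, (q.μ = lam ∨ q.ν = lam) → q.src lam = y' lam - 1 →
        (g + gS) q = 0 := by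
      intro lam hlR hlμ q hql hq
      by_cases hlν : lam = ν
      · subst hlν
        rw [Pi.add_apply, hgS, symm_apply_of_fixed lam y' g hql hq, add_neg_cancel]
      · have hl : lam ∉ insert ν R := fun h => (Finset.mem_insert.1 h).elim hlν hlR
        have hg0 : ∀ q : TPlaq P k, (q.μ = lam ∨ q.ν = lam) → q.src lam = y' lam - 1 → g q = 0 := hvan lam hl hlμ
        rw [Pi.add_apply, hg0 q hql hq, zero_add, hgS]
        exact symm_apply_eq_zero_of_ne hlν y' hg0 hql hq
    have hIH := ih hμR' (g + gS) hcl' hg' hvan'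
    -- the strip estimate for the closed field g
    have hR : ∀ p : TPlaq P 0, |resE hd ((P.eta k) ^ P.d) (P.eta k)⁻¹ k (toU P k g) p| ≤ KR * Real.sqrt ((P.eta k) ^ P.d) * C :=
      hKR g hcl C hC0 hg
    have hstrip := eta_abs_strip_le hd hk y' hμν g hC0 hg hR (hinf g C hg)
    rw [← hKs] at hstrip
    -- the symmetrisation identity `Σ_ℓT_k(g + S^*g) = Σ_ℓA + Σ_{ℓ⁻}A`
    have hsymm : ∑ t ∈ range (P.L ^ k), TkF P hd ((P.eta k) ^ P.d) (P.eta k) k (g + gS) (runBond (Site.scaleTo k y') μ t) =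
        ∑ t ∈ range (P.L ^ k), A (runBond (Site.scaleTo k y') μ t) +
          ∑ t ∈ range (P.L ^ k), A (runBond ((Site.scaleTo k y').unshift ν) μ t) := by
      rw [map_add, ← hA, hgS, TkF_symm hd hk ν y' g, ← hA, ← sum_runBond_symm hk hμν y' A (P.L ^ k), ← Finset.sum_add_distrib]
      rfl
    have hid : ∑ t ∈ range (P.L ^ k), A (runBond (Site.scaleTo k y') μ t) =
        (1 / 2 : ℝ) * (∑ t ∈ range (P.L ^ k), TkF P hd ((P.eta k) ^ P.d) (P.eta k) k (g + gS) (runBond (Site.scaleTo k y') μ t) +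
          (∑ t ∈ range (P.L ^ k), A (runBond (Site.scaleTo k y') μ t) -
            ∑ t ∈ range (P.L ^ k), A (runBond ((Site.scaleTo k y').unshift ν) μ t))) := by
      rw [hsymm]; ring
    rw [hid, abs_mul, abs_of_pos (by norm_num : (0 : ℝ) < 1 / 2), ← mul_assoc, mul_comm (P.eta k) (1 / 2), mul_assoc]
    have h2 : P.eta k * |∑ t ∈ range (P.L ^ k), TkF P hd ((P.eta k) ^ P.d) (P.eta k) k (g + gS) (runBond (Site.scaleTo k y') μ t) +
        (∑ t ∈ range (P.L ^ k), A (runBond (Site.scaleTo k y') μ t) -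
          ∑ t ∈ range (P.L ^ k), A (runBond ((Site.scaleTo k y').unshift ν) μ t))| ≤
        (Kfar + R.card * Ks / 2) * (2 * C) + Ks * C := by
      calc _ ≤ P.eta k * (|∑ t ∈ range (P.L ^ k), TkF P hd ((P.eta k) ^ P.d) (P.eta k) k (g + gS) (runBond (Site.scaleTo k y') μ t)| +
            |∑ t ∈ range (P.L ^ k), A (runBond (Site.scaleTo k y') μ t) -
              ∑ t ∈ range (P.L ^ k), A (runBond ((Site.scaleTo k y').unshift ν) μ t)|) :=
            mul_le_mul_of_nonneg_left (abs_add_le _ _) hη.le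
        _ ≤ (Kfar + R.card * Ks / 2) * (2 * C) + Ks * C := by
            rw [mul_add]
            exact add_le_add hIH hstrip
    rw [Finset.card_insert_of_notMem hνR, Nat.cast_add, Nat.cast_one]
    calc (1 / 2 : ℝ) * (P.eta k * |∑ t ∈ range (P.L ^ k), TkF P hd ((P.eta k) ^ P.d) (P.eta k) k (g + gS)
            (runBond (Site.scaleTo k y') μ t) +
          (∑ t ∈ range (P.L ^ k), A (runBond (Site.scaleTo k y') μ t) -
            ∑ t ∈ range (P.L ^ k), A (runBond ((Site.scaleTo k y').unshift ν) μ t))|)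
        ≤ (1 / 2 : ℝ) * ((Kfar + R.card * Ks / 2) * (2 * C) + Ks * C) := mul_le_mul_of_nonneg_left h2 (by norm_num)
      _ = (Kfar + (R.card + 1) * Ks / 2) * C := by ring

end Induction

/-! ## §4  The k-UNIFORM line-sum constant in every dimension: per torus, and on all tori hypothesis-free -/

section Uniform

/-- **THE k-UNIFORM LINE-SUM BOUND, EVERY `d ≥ 2`, GIVEN (7.2.2)–(7.2.3) AND THE RESIDUAL BOUND FOR CLOSED FIELDS** (`k ≤ m + K`):
for a CLOSED unit-lattice plaquette function `g` with `|g| ≤ C` and every unit bond `c`, `η·|Σ_{b′⊂c}(T_kg)_{b′}| ≤ K_T·C` with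
`K_T = K_far + (d−1)·(K_∞ + (1 + K_R)/2)` INDEPENDENT OF `k` — §3 with all `d − 1` directions `ν ≠ μ` treated (`R = univ ∖ {μ}`, vacuous
vanishing hypothesis).  (gen 10's `eta_abs_lineSumIter_TkF_le_uniform` is the case `d = 2`.) [cite: BalabanImbrieJaffe1985, (7.3.2) p.326] -/
theorem eta_abs_lineSumIter_TkF_le_uniform (hd : 2 ≤ P.d) {k : ℕ} (hk : k ≤ P.m + P.K) {a : ℝ} (ha : 0 < a)
    {δ M δC MC : ℝ} (hδ : 0 < δ) (hδC : 0 < δC) (hMC : 0 ≤ MC)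
    (hH : ∀ (j : ℕ) (hj : j ≤ P.m + P.K), j < k → ∀ (μ ν : Fin P.d) (x : TSite P 0) (y : TSite P j),
      |(torusRep P j (deltaAData hj a)).H (x, μ) (y, ν)| ≤ M * Real.exp (-(δ * distEU P j x y)))
    (hB : ∀ (j : ℕ) (hj : j ≤ P.m + P.K), j < k → ∀ (μ ν : Fin P.d) (x : TSite P 0) (y : TSite P j),
      ‖fun lam : Fin P.d => (P.L : ℝ) ^ j *
          ((torusRep P j (deltaAData hj a)).H (x.shift lam, μ) (y, ν) - (torusRep P j (deltaAData hj a)).H (x, μ) (y, ν))‖ ≤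
        M * Real.exp (-(δ * distEU P j x y)))
    (hC : ∀ j < k, ∀ b₁ b₂ : PBond P j, |⟪toEj P j (Pi.single b₁ 1),
      CE P ((P.eta j) ^ P.d) ((P.L : ℝ) ^ j) j (toEj P j (Pi.single b₂ 1))⟫| ≤ MC * Real.exp (-(δC * (supDist b₁.src b₂.src : ℝ))))
    {KR : ℝ}
    (hKR : ∀ g : TPlaq P k → ℝ, (∀ (x : TSite P k) (μ ν lam : Fin P.d) (hμν : μ < ν) (hνl : ν < lam), dPlaq g x hμν hνl = 0) →
      ∀ C : ℝ, 0 ≤ C → (∀ q, |g q| ≤ C) →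
        ∀ p : TPlaq P 0, |resE hd ((P.eta k) ^ P.d) (P.eta k)⁻¹ k (toU P k g) p| ≤ KR * Real.sqrt ((P.eta k) ^ P.d) * C)
    (g : TPlaq P k → ℝ) {C : ℝ}
    (hcl : ∀ (x : TSite P k) (μ ν lam : Fin P.d) (hμν : μ < ν) (hνl : ν < lam), dPlaq g x hμν hνl = 0)
    (hg : ∀ q, |g q| ≤ C) (c : PBond P (0 + k)) :
    P.eta k * |lineSumIter (TkF P hd ((P.eta k) ^ P.d) (P.eta k) k g) k c| ≤
      ((2 * M ^ 2 * MC * (P.d : ℝ) ^ 2 * (Real.exp (min δ δC / 2 / 2) * ((2 * (1 + P.d / (min δ δC / 2))) ^ P.d) ^ 2) *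
        (2 * (1 + 2 / (2 * (min δ δC / 2) / 3)) * Real.exp (3 * (2 * (min δ δC / 2) / 3) / 4) *
          ((P.d : ℝ) ^ 2 * (Real.exp ((2 * (min δ δC / 2) / 3) / 2 / 2) *
            (2 * (1 + P.d / ((2 * (min δ δC / 2) / 3) / 2))) ^ P.d))) *
        (Real.exp (min δ δC / 2 / 6) * (P.d - 2).factorial * ((min δ δC / 2 / 6)⁻¹) ^ (P.d - 2)) *
        (1 - Real.exp (-(min δ δC / 2 / 6)))⁻¹) +
      ((P.d : ℝ) - 1) * (2 * (2 * (2 * M ^ 2 * MC * (P.d : ℝ) ^ 2 * (Real.exp (min δ δC / 2 / 2) * ((2 * (1 + P.d / (min δ δC / 2))) ^ P.d) ^ 2) *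
        ((P.d : ℝ) ^ 2 * (2 * (1 + P.d / (min δ δC / 2))) ^ P.d))) + 1 + KR) / 2) * C := by
  classical
  set x₀ : TSite P 0 := cornerIter k c.src with hx₀
  set μ : Fin P.d := c.dir with hμ
  set y' : TSite P k := iterBlockOf k x₀ with hy'
  have hxy : x₀ = Site.scaleTo k y' := by rw [hy', hx₀]; exact cornerIter_eq_scaleTo hk c.src
  rw [lineSumIter_eq_sum_runBond _ k (by omega) c]
  have h := eta_abs_sum_TkF_le_induct hd hk ha hδ hδC hMC hH hB hC hKR y' μ (univ.erase μ) (Finset.notMem_erase μ univ) g hcl hg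
    (fun lam hl hlμ => absurd (Finset.mem_erase.2 ⟨hlμ, Finset.mem_univ lam⟩) hl)
  rw [Finset.card_erase_of_mem (Finset.mem_univ μ), Finset.card_univ, Fintype.card_fin,
    Nat.cast_sub (by have := P.hd; omega), Nat.cast_one] at h
  rw [show cornerIter k c.src = x₀ from rfl, hxy]
  exact h

/-- kernel: weakening a kernel bound to a larger prefactor and a smaller rate (p09). [folklore] -/
private theorem weaken_bound {M₁ M₂ δ₁ δ₂ t v : ℝ} (hM : M₁ ≤ M₂) (hM₂ : 0 ≤ M₂) (hδ : δ₂ ≤ δ₁) (ht : 0 ≤ t)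
    (h : v ≤ M₁ * Real.exp (-(δ₁ * t))) : v ≤ M₂ * Real.exp (-(δ₂ * t)) :=
  h.trans ((mul_le_mul_of_nonneg_right hM (Real.exp_pos _).le).trans
    (mul_le_mul_of_nonneg_left (Real.exp_le_exp.2 (by nlinarith)) hM₂))

/-- kernel: `0 ≤ |x − y|`. [folklore] -/
private theorem distEU_nonneg' {j : ℕ} (x : TSite P 0) (y : TSite P j) : 0 ≤ distEU P j x y := by
  rw [distEU]; positivity

/-- **`K_T` UNIFORM IN `k` ON ALL TORI OF EVERY DIMENSION, HYPOTHESIS-FREE**: for every `d ≥ 2` and odd `L > 1` there is ONE `K_T ≥ 0`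
such that on every torus of the series with `P.d = d`, `P.L = L` (any volume exponent `m`, any number of steps `K`), for EVERY scale
`k ≤ m + K`, every CLOSED unit-lattice plaquette function `g` with `|g| ≤ C` and every unit bond `c`, `η·|Σ_{b′⊂c}(T_kg)_{b′}| ≤ K_T·C` —
§4 fed with the all-tori members of (7.2.2) (p16/p19: `exists_absH_le_allTori`, `exists_gradB_allTori`; scale `0`: `abs_H_zero_le`),
the all-tori (7.2.3) (`ineq723_CE`) and the all-tori residual bound for closed fields (p33's `exists_KR_allTori`, [6I] Prop. 1.2 inside).
p11's `SecClosedIdx.hT` thus holds on every torus of every dimension with a `k`-INDEPENDENT `K_T` (gen 10's `exists_KT_uniform_allTori`: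
`d = 2`; p09's `exists_KT_linear_allTori`: `d = 2`, `K₀·k`). [cite: BalabanImbrieJaffe1985, (7.3.2) p.326] -/
theorem exists_KT_uniform_allTori {d L : ℕ} (hdd : 2 ≤ d) (hL : Odd L ∧ 1 < L) :
    ∃ KT : ℝ, 0 ≤ KT ∧ ∀ (P : Params) (hPd : P.d = d) (hPL : P.L = L) (hd : 2 ≤ P.d) (k : ℕ) (hk : k ≤ P.m + P.K)
      (g : TPlaq P k → ℝ), IsClosedPlaq g → ∀ (C : ℝ), (∀ q, |g q| ≤ C) → ∀ c : PBond P (0 + k),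
      P.eta k * |lineSumIter (TkF P hd ((P.eta k) ^ P.d) (P.eta k) k g) k c| ≤ KT * C := by
  obtain ⟨δH, MH, hδH, hMH, hHall⟩ := exists_absH_le_allTori (d := d) (L := L) (by omega) hL one_pos
  obtain ⟨δB, MB, hδB, hMB, hBall⟩ := exists_gradB_allTori (d := d) (L := L) (by omega) hL one_pos
  obtain ⟨MC, δC, hMC, hδC, hCall⟩ := ineq723_CE d L hdd
  obtain ⟨KR, hKR, hRall⟩ := exists_KR_allTori (d := d) (L := L) hdd one_pos
  set δ : ℝ := min δH δB with hδdef
  set M : ℝ := max MH MB with hMdef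
  have hδ : 0 < δ := lt_min hδH hδB
  have hM1 : 1 ≤ M := hMH.trans (le_max_left _ _)
  have hM0 : 0 ≤ M := zero_le_one.trans hM1
  set a₀ : ℝ := min δ δC / 2 with ha₀
  have ha₀p : 0 < a₀ := half_pos (lt_min hδ hδC)
  have hd0 : (0 : ℝ) ≤ (d : ℝ) - 1 := by
    have : (2 : ℝ) ≤ d := by exact_mod_cast hdd
    linarith
  set K1 : ℝ := Real.exp (a₀ / 2) * ((2 * (1 + (d : ℝ) / a₀)) ^ d) ^ 2 with hK1
  set Kfar : ℝ := 2 * M ^ 2 * MC * (d : ℝ) ^ 2 * K1 *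
      (2 * (1 + 2 / (2 * a₀ / 3)) * Real.exp (3 * (2 * a₀ / 3) / 4) *
        ((d : ℝ) ^ 2 * (Real.exp ((2 * a₀ / 3) / 2 / 2) * (2 * (1 + (d : ℝ) / ((2 * a₀ / 3) / 2))) ^ d))) *
      (Real.exp (a₀ / 6) * (d - 2).factorial * ((a₀ / 6)⁻¹) ^ (d - 2)) *
      (1 - Real.exp (-(a₀ / 6)))⁻¹ with hKfar
  set Kinf : ℝ := 2 * (2 * M ^ 2 * MC * (d : ℝ) ^ 2 * K1 * ((d : ℝ) ^ 2 * (2 * (1 + (d : ℝ) / a₀)) ^ d)) with hKinf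
  have hr : Real.exp (-(a₀ / 6)) < 1 := Real.exp_lt_one_iff.2 (by linarith)
  have hr' : 0 < 1 - Real.exp (-(a₀ / 6)) := by linarith
  have hKs0 : 0 ≤ 2 * Kinf + 1 + KR := by
    have : 0 ≤ Kinf := by positivity
    linarith
  have hKT0 : 0 ≤ Kfar + ((d : ℝ) - 1) * (2 * Kinf + 1 + KR) / 2 :=
    add_nonneg (by positivity) (div_nonneg (mul_nonneg hd0 hKs0) two_pos.le)
  refine ⟨Kfar + ((d : ℝ) - 1) * (2 * Kinf + 1 + KR) / 2, hKT0, fun P hPd hPL hd k hk g hgcl C hg c => ?_⟩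
  have hH : ∀ (j : ℕ) (hj : j ≤ P.m + P.K), j < k → ∀ (μ ν : Fin P.d) (x : TSite P 0) (y : TSite P j),
      |(torusRep P j (deltaAData hj 1)).H (x, μ) (y, ν)| ≤ M * Real.exp (-(δ * distEU P j x y)) := by
    intro j hj _ μ ν x y
    rcases Nat.eq_zero_or_pos j with hj0 | hjpos
    · subst hj0
      exact abs_H_zero_le hj one_pos hM1 δ μ ν x y
    · exact weaken_bound (le_max_left _ _) hM0 (min_le_left _ _) (distEU_nonneg' x y) (hHall P hPd hPL j hjpos hj μ ν x y)
  have hB : ∀ (j : ℕ) (hj : j ≤ P.m + P.K), j < k → ∀ (μ ν : Fin P.d) (x : TSite P 0) (y : TSite P j),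
      ‖fun lam : Fin P.d => (P.L : ℝ) ^ j *
          ((torusRep P j (deltaAData hj 1)).H (x.shift lam, μ) (y, ν) - (torusRep P j (deltaAData hj 1)).H (x, μ) (y, ν))‖ ≤
        M * Real.exp (-(δ * distEU P j x y)) := by
    intro j hj _ μ ν x y
    exact weaken_bound (le_max_right _ _) hM0 (min_le_right _ _) (distEU_nonneg' x y) (hBall P hPd hPL j hj μ ν x y)
  have hC : ∀ j < k, ∀ b₁ b₂ : PBond P j, |⟪toEj P j (Pi.single b₁ 1),
      CE P ((P.eta j) ^ P.d) ((P.L : ℝ) ^ j) j (toEj P j (Pi.single b₂ 1))⟫| ≤ MC * Real.exp (-(δC * (supDist b₁.src b₂.src : ℝ))) :=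
    fun j hjk b₁ b₂ => hCall P hPd hPL j inferInstance (by omega) b₁ b₂
  have hC0 : 0 ≤ C := nonneg_of_bound' hd hg
  -- the case k = 0 (no residual bound available, none needed)
  rcases Nat.eq_zero_or_pos k with hk0 | hkpos
  · subst hk0
    rw [lineSumIter_TkF_eq hd hk]
    simp only [Finset.range_zero, Finset.sum_empty, mul_zero, Finset.sum_const_zero, abs_zero]
    positivity
  have hKRall : ∀ f : TPlaq P k → ℝ, (∀ (x : TSite P k) (μ ν lam : Fin P.d) (hμν : μ < ν) (hνl : ν < lam), dPlaq f x hμν hνl = 0) →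
      ∀ D : ℝ, 0 ≤ D → (∀ q, |f q| ≤ D) →
        ∀ p : TPlaq P 0, |resE hd ((P.eta k) ^ P.d) (P.eta k)⁻¹ k (toU P k f) p| ≤ KR * Real.sqrt ((P.eta k) ^ P.d) * D :=
    fun f hf D hD hfD p => hRall P hPd hPL k hkpos hk f ((isClosedPlaq_iff_dPlaq f).2 hf) D hD hfD p
  have h := eta_abs_lineSumIter_TkF_le_uniform hd hk one_pos hδ hδC hMC.le hH hB hC hKRall g ((isClosedPlaq_iff_dPlaq g).1 hgcl) hg c
  simp only [hPd] at h ⊢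
  simpa only [hKfar, hKinf, hK1, ha₀] using h

/-- **`SecClosedIdx d K_R K_T 𝓅` IS TOTAL OVER THE ACTUAL Sect. 7.3 DATA ON EVERY TORUS OF EVERY DIMENSION WITH A k-INDEPENDENT `K_T`,
HYPOTHESIS-FREE**: for every `d ≥ 2`, odd `L > 1`, `a > 0` and `𝓅` there are ONE `K_R ≥ 1` (p33's `closedIdx_allTori`) and ONE `K_T ≥ 0`
(`exists_KT_uniform_allTori`) such that every torus `P` with `P.d = d`, `P.L = L`, every scale `1 ≤ k ≤ m + K`, every `0 < e ≤ 1` with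
`e𝓅(e) ≤ ½` and every unit `U(1)` field `v` give an index of p11's `SecClosedIdx d K_R K_T 𝓅` — items (γ′), (δ), (ε) of GAPS G-C1-05
ADDENDA 7–10 in every dimension (gen 10's `secClosedIdx_allTori_two_uniform`: `d = 2`). [cite: BalabanImbrieJaffe1985, (7.3.1)–(7.3.2) p.326] -/
theorem secClosedIdx_allTori_uniform {d L : ℕ} (hdd : 2 ≤ d) (hL : Odd L ∧ 1 < L) {a : ℝ} (ha : 0 < a) (pexp : ℝ) :
    ∃ KR KT : ℝ, 1 ≤ KR ∧ 0 ≤ KT ∧ ∀ (P : Params), P.d = d → P.L = L → ∀ (k : ℕ), 1 ≤ k → k ≤ P.m + P.K →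
      ∀ (e : ℝ) (he : 0 < e) (he1 : e ≤ 1) (hsmall : e * (1 + Real.log e⁻¹) ^ pexp ≤ 1 / 2) (v : U1Field P k),
        ∃ i : SecClosedIdx d KR KT pexp, i.P = P ∧ i.k = k ∧ i.e = e ∧ HEq i.v v := by
  obtain ⟨KR, hKR, hidx⟩ := closedIdx_allTori (d := d) (L := L) hdd ha pexp
  obtain ⟨KT, hKT, hT⟩ := exists_KT_uniform_allTori hdd hL
  refine ⟨KR, KT, hKR, hKT, fun P hPd hPL k hk1 hk e he he1 hsmall v => ?_⟩
  obtain ⟨i, hP, hk', he', hv⟩ := hidx P hPd hPL k hk1 hk e he he1 hsmall v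
  subst hP hk' he'
  exact ⟨{ toClosedIdx := i
           hT := fun g hg C hgC c => hT i.P hPd hPL i.hd2 i.k i.hk g ((isClosedPlaq_iff_dPlaq g).2 hg) C hgC c }, rfl, rfl, rfl, hv⟩

end Uniform

/-! ## §5  Consequences: r15's `Claim73 𝓅` in the second printed form with k-independent constants, and the substitution error -/

section Consequences

/-- **r15's `Claim73 𝓅` IN ITS SECOND PRINTED FORM ON EVERY TORUS OF EVERY DIMENSION, CONSTANTS INDEPENDENT OF THE SCALE**: for every
`d ≥ 2`, odd `L > 1`, `a > 0` (feeding `K_R`), `a₀ > 0` (the printed `a` of (4.6.4)) and `𝓅` there are ONE `K_R ≥ 1` and ONE `K_T ≥ 0`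
such that (a) `Claim73 𝓅` holds for p11's second-form family `secClosedStabData a₀` over `SecClosedIdx d K_R K_T 𝓅` (ONE family;
`γ`, `α`, `M` independent of `k`, p11's `claim73_second_closed`), and (b) that family contains EVERY actual datum of every scale
`1 ≤ k ≤ m + K` on every torus with `P.d = d`, `P.L = L` (gen 10's `claim73_second_closed_allTori_two_uniform`: `d = 2`).
[cite: BalabanImbrieJaffe1985, (7.3.1)–(7.3.2) p.326] -/
theorem claim73_second_closed_allTori_uniform {d L : ℕ} (hdd : 2 ≤ d) (hL : Odd L ∧ 1 < L) {a : ℝ} (ha : 0 < a) (a₀ : ℝ)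
    (ha₀ : 0 < a₀) (pexp : ℝ) :
    ∃ KR KT : ℝ, 1 ≤ KR ∧ 0 ≤ KT ∧
      BIJ85Sect7Statements.ScalarStabData.Claim73 pexp (secClosedStabData (d := d) (KR := KR) (KT := KT) (pexp := pexp) a₀ ha₀) ∧
      ∀ (P : Params), P.d = d → P.L = L → ∀ (k : ℕ), 1 ≤ k → k ≤ P.m + P.K →
        ∀ (e : ℝ) (he : 0 < e) (he1 : e ≤ 1) (hsmall : e * (1 + Real.log e⁻¹) ^ pexp ≤ 1 / 2) (v : U1Field P k),
          ∃ i : SecClosedIdx d KR KT pexp, i.P = P ∧ i.k = k ∧ i.e = e ∧ HEq i.v v := by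
  obtain ⟨KR, KT, hKR, hKT, h⟩ := secClosedIdx_allTori_uniform hdd hL ha pexp
  exact ⟨KR, KT, hKR, hKT, claim73_second_closed a₀ ha₀ KR KT pexp, h⟩

/-- **`‖u_k(c) − v_c‖ ≤ e_k·K_T·(π/2)𝓅(e_k)` ON EVERY TORUS OF EVERY DIMENSION UNDER (7.3.1), ONE `K_T` FOR ALL SCALES** — the defect
of substituting `v_b` for `u_k(b)` (the actual background (4.5.4) computed from `v` with the operators of record) along every unit
bond: for every `d ≥ 2` and odd `L > 1` ONE `K_T ≥ 0` serves all tori with `P.d = d`, `P.L = L`, all scales `k ≤ m + K`, all `e > 0`,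
all `𝓅` and all `v` with `|v(∂p) − 1| ≤ e𝓅(e) ≤ ½` (in `d ≥ 3` the smallness makes `f^{(k)}` closed, p33 g7's `dPlaq_plaqField_eq_zero`;
gen 10's `norm_lineIter_actualBgU1_sub_vK_le_two_uniform` is the case `d = 2`, where no smallness is needed).
[cite: BalabanImbrieJaffe1985, (7.3.1)–(7.3.2) p.326] -/
theorem norm_lineIter_actualBgU1_sub_vK_le_uniform {d L : ℕ} (hdd : 2 ≤ d) (hL : Odd L ∧ 1 < L) :
    ∃ KT : ℝ, 0 ≤ KT ∧ ∀ (P : Params) (hPd : P.d = d), P.L = L → ∀ (k : ℕ) (hk : k ≤ P.m + P.K) (e : ℝ), 0 < e →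
      ∀ (pexp : ℝ), e * (1 + Real.log e⁻¹) ^ pexp ≤ 1 / 2 → ∀ (v : U1Field P k),
        (∀ p, ‖((plaq v p : Circle) : ℂ) - 1‖ ≤ e * (1 + Real.log e⁻¹) ^ pexp) →
        ∀ c : PBond P (0 + k),
          ‖toC (lineIter (actualBgU1 (hdd.trans_eq hPd.symm) k e v) k c) - toC (vK k v c)‖ ≤
            e * (KT * (Real.pi / 2 * (1 + Real.log e⁻¹) ^ pexp)) := by
  obtain ⟨KT, hKT, hT⟩ := exists_KT_uniform_allTori hdd hL
  refine ⟨KT, hKT, fun P hPd hPL k hk e he pexp hsmall v h c => ?_⟩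
  have hd : 2 ≤ P.d := hdd.trans_eq hPd.symm
  have hf := abs_plaqField_le_of_hyp he v h
  have hcl : IsClosedPlaq (plaqField e v) := (isClosedPlaq_iff_dPlaq _).2 (dPlaq_plaqField_eq_zero he v hsmall h)
  have hT' := hT P hPd hPL hd k hk (plaqField e v) hcl _ hf c
  have h1 := norm_toC_lineIter_actualBgU1_sub_le hd hk e v c
  rw [abs_of_pos he] at h1
  calc ‖toC (lineIter (actualBgU1 hd k e v) k c) - toC (vK k v c)‖
      ≤ e * P.eta k * |lineSumIter (TkF P hd ((P.eta k) ^ P.d) (P.eta k) k (plaqField e v)) k c| := h1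
    _ = e * (P.eta k * |lineSumIter (TkF P hd ((P.eta k) ^ P.d) (P.eta k) k (plaqField e v)) k c|) := by ring
    _ ≤ e * (KT * (Real.pi / 2 * (1 + Real.log e⁻¹) ^ pexp)) := mul_le_mul_of_nonneg_left hT' he.le

end Consequences

end

end Literature.MathematicalPhysics.QuantumFieldTheory.BalabanImbrieJaffe1984to88.BIJ85LineSumReflectionD
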